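import Summits.ABC.IUTFork.Joshi.ArithTeichmullerAction
import Mathlib.NumberTheory.Padics.ProperSpace
import Mathlib.Analysis.Normed.Unbundled.SpectralNorm
import Mathlib.Analysis.SpecialFunctions.Pow.Real
import HarnessLib

/-!
# Joshi, *Arithmetic Teichmüller spaces I* — the VALUATION SCALING between two holomorphic structures is a THEOREM of
# the typing ([J-I] v4 Thm 5.4.1, existence half), from Mathlib (compactness of `ℤ_p` + uniqueness of the spectral norm)

Proof-only file of the abc-iut cell, branch E (seat abc-iut-E-t1; rung LADDER-ABC:A2.E); sequel to
`ArithTeichmullerAction` (p429850: the points-signature `UntiltPoints p 𝒪E` with residue fields `K_y` and the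
preferred algebraic closures `algCl y : Q̄_p →+* K_y`, continuous on `ℚ_p`; the reading predicate
`IsDilatation y y′ r : ∀ x, ‖algCl y′ x‖ = ‖algCl y x‖ ^ r`). TAKES NO SIDE on [IUTchIII] Cor. 3.12 or on any
author; typed ≠ proved ≠ endorsed. No new mathematical objects beyond three auxiliaries (`normQp`, `exponent`, the
absolute value `rootAbs`); no `Prop` facts; every statement below is PROVED.

THE PRINTED STATEMENT (K. Joshi, arXiv 2106.11452 **v4** (version of record; render
`HOME/plan/repair/lit/renders/Joshi-ATS1-2106.11452v4-…`) **Thm 5.4.1**, p.26 l.75 – p.27 l.5): «Let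
`(Y/E′, (E′ ↪ K₁, K₁♭ ≃ F), ∗_{K₁})` and `(Y/E′, (E′ ↪ K₂, K₂♭ ≃ F), ∗_{K₂})` be two objects of `𝔍(X,E)`. Let
`(E′, |−|_{K₁})`, `(E′, |−|_{K₂})` be the restriction of the absolute value of `K₁` to `E′` (resp. of `K₂` to `E′`).
Then there exists a real number `α ∈ ℝ` such that `(E′, |−|_{K₂}) = (E′, |−|^α_{K₁})`. However, there is no uniform
choice of `α` for all pairs of objects of `𝔍(X,E)`» (proof in print, p.27 l.1–5: «the two valuations on `E′` induced
from `K₁, K₂` on `E′` are equivalent. Hence existence of `α ∈ ℝ` as asserted is clear. The second assertion is now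
immediate from the existence of Fargues–Fontaine curves»); 2021 version: §1 chunk p0003 / §10 (pa:norm-example)
chunk p0026 «the valuations of elements such as `p` … (and also valuations of elements of `Q̄_p`) undergo a dilatation
or scaling». [claim: Joshi2021ATS1, status: disputed]

WHAT IS PROVED HERE (the EXISTENCE half, for the points of a signature `D : UntiltPoints p 𝒪E`, read on the
preferred algebraic closures — exactly the shape of `UntiltPoints.IsDilatation`):
* `normQp_eq_rpow`: the absolute value of `K_y` pulled back to `ℚ_p` IS `|·|_p^{c_y}` for the positive real
  `c_y = exponent D y` — a continuous multiplicative absolute value on `ℚ_p` with `|p| < 1` is a power of `|·|_p`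
  (units have absolute value `1` by compactness of the unit ball, Mathlib `ProperSpace ℚ_[p]`);
* `norm_algCl_eq_rpow`: the absolute value of `K_y` pulled back to `Q̄_p = PadicAlgCl p` IS `‖·‖^{c_y}` for
  Mathlib's `p`-adic (spectral) norm — uniqueness of the extension of an absolute value from the complete field
  `ℚ_p` to the algebraic extension `Q̄_p`, Mathlib `spectralNorm_unique_field_norm_ext` (applied to the
  `c_y⁻¹`-th power, which is again an absolute value because the norm of `K_y` is ultrametric);
* `exists_isDilatation`: **for any two points `y, y′` there is `r > 0` with `IsDilatation y y′ r`** (`r = c_{y′}/c_y`)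
  — the existence half of Thm 5.4.1 as a kernel theorem of the typing. The NON-UNIFORMITY half («no uniform
  choice of α», Cor. 5.4.2 «the p-adic metrics … are scaled») remains the claim-Prop `UntiltPoints.ActionDilates`
  (it needs the Fargues–Fontaine curve / [KedlayaTemkin2018]-type input, not in the tree).
Consequence worth recording for the test vs `S` (no side taken): what distinguishes two holomorphic structures
on `Q̄_p` is ONE positive real number (the exponent); `norm_p_ne_of_isDilatation` (p429850) says `r ≠ 1` moves
`‖p‖`. [folklore]
-/

noncomputable section

namespace Summit.ABC.IUTFork.Joshi

namespace UntiltPoints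

open Filter

variable {p : ℕ} [Fact p.Prime] {𝒪E : Type} [CommRing 𝒪E] (D : UntiltPoints p 𝒪E)

/-! ## 1. The absolute value of `K_y` pulled back to `ℚ_p` is a power of `|·|_p` -/

/-- The absolute value of the residue field `K_y`, pulled back to `ℚ_p` along `ℚ_p ⊆ Q̄_p ↪ K_y`. [folklore] -/
def normQp (y : D.Pt) (a : ℚ_[p]) : ℝ := ‖D.algCl y (algebraMap ℚ_[p] (AlgebraicClosure ℚ_[p]) a)‖

/-- `normQp` is continuous (the preferred algebraic closure is continuous on `ℚ_p`). [folklore] -/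
theorem continuous_normQp (y : D.Pt) : Continuous (D.normQp y) :=
  continuous_norm.comp (D.continuous_algCl y)

/-- `normQp` is multiplicative. [folklore] -/
theorem normQp_mul (y : D.Pt) (a b : ℚ_[p]) : D.normQp y (a * b) = D.normQp y a * D.normQp y b := by
  simp [normQp, map_mul, norm_mul]

/-- `normQp 1 = 1`. [folklore] -/
theorem normQp_one (y : D.Pt) : D.normQp y 1 = 1 := by simp [normQp]

/-- `normQp` is nonnegative. [folklore] -/
theorem normQp_nonneg (y : D.Pt) (a : ℚ_[p]) : 0 ≤ D.normQp y a := norm_nonneg _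

/-- `normQp` of a power. [folklore] -/
theorem normQp_pow (y : D.Pt) (a : ℚ_[p]) (k : ℕ) : D.normQp y (a ^ k) = D.normQp y a ^ k := by
  simp [normQp, map_pow, norm_pow]

/-- `normQp` of an integer power. [folklore] -/
theorem normQp_zpow (y : D.Pt) (a : ℚ_[p]) (k : ℤ) : D.normQp y (a ^ k) = D.normQp y a ^ k := by
  simp [normQp, map_zpow₀, norm_zpow]

/-- `0 < normQp p < 1`. [folklore] -/
theorem normQp_p (y : D.Pt) : 0 < D.normQp y p ∧ D.normQp y p < 1 := by
  have h := D.norm_algCl_p y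
  simp only [normQp, map_natCast] at h ⊢
  exact h

/-- **Units have absolute value one**: if `‖u‖_p = 1` then `normQp u = 1`. Proof: `normQp` is continuous, hence
bounded on the compact unit ball of `ℚ_p` (`ProperSpace ℚ_[p]`); all powers of `u` and of `u⁻¹` lie in the unit
ball, so neither `normQp u > 1` nor `normQp u⁻¹ > 1` is possible. [folklore] -/
theorem normQp_eq_one_of_norm_eq_one (y : D.Pt) {u : ℚ_[p]} (hu : ‖u‖ = 1) : D.normQp y u = 1 := by
  -- a bound on the unit ball
  have hcpt : IsCompact (Metric.closedBall (0 : ℚ_[p]) 1) := isCompact_closedBall 0 1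
  obtain ⟨M, hM⟩ : ∃ M : ℝ, ∀ a ∈ Metric.closedBall (0 : ℚ_[p]) 1, D.normQp y a ≤ M := by
    obtain ⟨M, hM⟩ := hcpt.bddAbove_image (D.continuous_normQp y).continuousOn
    exact ⟨M, fun a ha => hM ⟨a, ha, rfl⟩⟩
  -- any element of norm 1 has normQp ≤ 1
  have hle : ∀ w : ℚ_[p], ‖w‖ = 1 → D.normQp y w ≤ 1 := by
    intro w hw
    by_contra hgt
    rw [not_le] at hgt
    obtain ⟨k, hk⟩ := pow_unbounded_of_one_lt M hgt
    have hmem : w ^ k ∈ Metric.closedBall (0 : ℚ_[p]) 1 := by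
      simp [Metric.mem_closedBall, dist_zero_right, norm_pow, hw]
    have := hM _ hmem
    rw [D.normQp_pow] at this
    exact absurd (lt_of_lt_of_le hk this) (lt_irrefl M)
  have hu0 : u ≠ 0 := by
    intro h; rw [h, norm_zero] at hu; exact zero_ne_one hu
  have h1 : D.normQp y u ≤ 1 := hle u hu
  have h2 : D.normQp y u⁻¹ ≤ 1 := hle u⁻¹ (by rw [norm_inv, hu, inv_one])
  have hprod : D.normQp y u * D.normQp y u⁻¹ = 1 := by
    rw [← D.normQp_mul, mul_inv_cancel₀ hu0, D.normQp_one]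
  have hpos : 0 ≤ D.normQp y u := D.normQp_nonneg y u
  have hpos' : 0 ≤ D.normQp y u⁻¹ := D.normQp_nonneg y u⁻¹
  nlinarith [mul_le_mul h1 h2 hpos' zero_le_one]

/-- THE EXPONENT of the holomorphic structure `y`: the positive real `c_y` with `|p|_{K_y} = |p|_p^{c_y}`, i.e.
`c_y = log ‖p‖_{K_y} / log (p⁻¹)`. [folklore] -/
def exponent (y : D.Pt) : ℝ := Real.log (D.normQp y p) / Real.log ((p : ℝ)⁻¹)

/-- The exponent is positive (both logarithms are negative). [folklore] -/
theorem exponent_pos (y : D.Pt) : 0 < D.exponent y := by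
  have hp : 1 < (p : ℝ) := by exact_mod_cast (Fact.out : p.Prime).one_lt
  have h1 : Real.log (D.normQp y p) < 0 := Real.log_neg (D.normQp_p y).1 (D.normQp_p y).2
  have h2 : Real.log ((p : ℝ)⁻¹) < 0 := Real.log_neg (inv_pos.2 (by linarith)) (inv_lt_one_of_one_lt₀ hp)
  exact div_pos_of_neg_of_neg h1 h2

/-- `(p⁻¹)^{c_y} = ‖p‖_{K_y}` (definition of the exponent, unfolded). [folklore] -/
theorem inv_p_rpow_exponent (y : D.Pt) : ((p : ℝ)⁻¹) ^ D.exponent y = D.normQp y p := by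
  have hp : 1 < (p : ℝ) := by exact_mod_cast (Fact.out : p.Prime).one_lt
  have hpinv : 0 < ((p : ℝ)⁻¹) := inv_pos.2 (by linarith)
  have hlog : Real.log ((p : ℝ)⁻¹) ≠ 0 :=
    (Real.log_neg hpinv (inv_lt_one_of_one_lt₀ hp)).ne
  rw [Real.rpow_def_of_pos hpinv, exponent, mul_comm, div_mul_cancel₀ _ hlog, Real.exp_log (D.normQp_p y).1]

/-- **The pulled-back absolute value on `ℚ_p` is `|·|_p^{c_y}`.** [folklore] -/
theorem normQp_eq_rpow (y : D.Pt) (a : ℚ_[p]) : D.normQp y a = ‖a‖ ^ D.exponent y := by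
  by_cases ha : a = 0
  · subst ha
    simp [normQp, Real.zero_rpow (D.exponent_pos y).ne']
  -- write a = u * p^v with ‖u‖ = 1
  have hp : 1 < (p : ℝ) := by exact_mod_cast (Fact.out : p.Prime).one_lt
  have hp0 : (0 : ℝ) < p := by linarith
  have hpQ : (p : ℚ_[p]) ≠ 0 := by exact_mod_cast (Fact.out : p.Prime).ne_zero
  set v : ℤ := a.valuation with hv
  have hnorm : ‖a‖ = (p : ℝ) ^ (-v) := Padic.norm_eq_zpow_neg_valuation ha
  set u : ℚ_[p] := a * (p : ℚ_[p]) ^ (-v) with hu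
  have hu1 : ‖u‖ = 1 := by
    rw [hu, norm_mul, norm_zpow, Padic.norm_p, hnorm, ← mul_zpow, mul_inv_cancel₀ hp0.ne', one_zpow]
  have hau : a = u * (p : ℚ_[p]) ^ v := by
    rw [hu, mul_assoc, ← zpow_add₀ hpQ, neg_add_cancel, zpow_zero, mul_one]
  have hnu : D.normQp y u = 1 := D.normQp_eq_one_of_norm_eq_one y hu1
  calc D.normQp y a = D.normQp y u * D.normQp y ((p : ℚ_[p]) ^ v) := by rw [hau, D.normQp_mul]
    _ = D.normQp y p ^ v := by rw [hnu, one_mul, D.normQp_zpow]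
    _ = (((p : ℝ)⁻¹) ^ D.exponent y) ^ v := by rw [D.inv_p_rpow_exponent]
    _ = (((p : ℝ)⁻¹) ^ (v : ℝ)) ^ D.exponent y := by
          rw [← Real.rpow_intCast, ← Real.rpow_mul (inv_pos.2 hp0).le, mul_comm,
            Real.rpow_mul (inv_pos.2 hp0).le]
    _ = ‖a‖ ^ D.exponent y := by
          rw [hnorm, Real.rpow_intCast, inv_zpow', ]

/-! ## 2. … hence on `Q̄_p` it is the `c_y`-th power of the `p`-adic (spectral) norm -/

/-- The `c_y⁻¹`-th power of the pulled-back absolute value, as an absolute value on `Q̄_p = PadicAlgCl p` (it is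
multiplicative, and subadditive because the norm of `K_y` is ultrametric). [folklore] -/
def rootAbs (y : D.Pt) : AbsoluteValue (PadicAlgCl p) ℝ where
  toFun x := ‖D.algCl y x‖ ^ (D.exponent y)⁻¹
  map_mul' x x' := by
    simp only [map_mul, norm_mul]
    exact Real.mul_rpow (norm_nonneg _) (norm_nonneg _)
  nonneg' x := Real.rpow_nonneg (norm_nonneg _) _
  eq_zero' x := by
    rw [Real.rpow_eq_zero_iff_of_nonneg (norm_nonneg _)]
    simp [norm_eq_zero, map_eq_zero_iff _ (D.algCl y).injective, (inv_pos.2 (D.exponent_pos y)).ne']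
  add_le' x x' := by
    have hinv : 0 ≤ (D.exponent y)⁻¹ := (inv_pos.2 (D.exponent_pos y)).le
    have hultra : ‖D.algCl y (x + x')‖ ≤ max ‖D.algCl y x‖ ‖D.algCl y x'‖ := by
      rw [map_add]; exact IsUltrametricDist.norm_add_le_max _ _
    calc ‖D.algCl y (x + x')‖ ^ (D.exponent y)⁻¹
        ≤ (max ‖D.algCl y x‖ ‖D.algCl y x'‖) ^ (D.exponent y)⁻¹ :=
          Real.rpow_le_rpow (norm_nonneg _) hultra hinv
      _ ≤ ‖D.algCl y x‖ ^ (D.exponent y)⁻¹ + ‖D.algCl y x'‖ ^ (D.exponent y)⁻¹ := by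
          rcases le_total ‖D.algCl y x‖ ‖D.algCl y x'‖ with h | h
          · rw [max_eq_right h]
            exact le_add_of_nonneg_left (Real.rpow_nonneg (norm_nonneg _) _)
          · rw [max_eq_left h]
            exact le_add_of_nonneg_right (Real.rpow_nonneg (norm_nonneg _) _)

/-- Unfolding of `rootAbs`. [folklore] -/
theorem rootAbs_apply (y : D.Pt) (x : PadicAlgCl p) : D.rootAbs y x = ‖D.algCl y x‖ ^ (D.exponent y)⁻¹ := rfl

/-- `rootAbs` extends the `p`-adic norm of `ℚ_p`. [folklore] -/
theorem rootAbs_extends (y : D.Pt) (a : ℚ_[p]) : D.rootAbs y (algebraMap ℚ_[p] (PadicAlgCl p) a) = ‖a‖ := by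
  rw [rootAbs_apply]
  change D.normQp y a ^ (D.exponent y)⁻¹ = ‖a‖
  rw [D.normQp_eq_rpow, Real.rpow_rpow_inv (norm_nonneg _) (D.exponent_pos y).ne']

/-- **The pulled-back absolute value on `Q̄_p` is `‖·‖^{c_y}`** for Mathlib's `p`-adic norm of `PadicAlgCl p`
(uniqueness of the extension of `|·|_p` from the complete field `ℚ_p` to its algebraic closure: Mathlib
`spectralNorm_unique_field_norm_ext`, applied to `rootAbs`). [folklore] -/
theorem norm_algCl_eq_rpow (y : D.Pt) (x : AlgebraicClosure ℚ_[p]) :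
    ‖D.algCl y x‖ = ‖(x : PadicAlgCl p)‖ ^ D.exponent y := by
  have h : D.rootAbs y x = spectralNorm ℚ_[p] (PadicAlgCl p) x :=
    spectralNorm_unique_field_norm_ext (D.rootAbs_extends y) x
  have hx : ‖(x : PadicAlgCl p)‖ = spectralNorm ℚ_[p] (PadicAlgCl p) x := rfl
  rw [rootAbs_apply] at h
  rw [hx, ← h, Real.rpow_inv_rpow (norm_nonneg _) (D.exponent_pos y).ne']

/-! ## 3. [J-I] v4 Thm 5.4.1, existence half: any two holomorphic structures differ by a DILATATION -/

/-- **[J-I] v4 Thm 5.4.1 (existence of the scaling exponent), as a THEOREM of the typing**: for any two points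
`y, y′` of a points-signature the absolute values of `K_y`, `K_{y′}` read on the preferred algebraic closures
differ by a positive power: `IsDilatation y y′ (c_{y′}/c_y)`. «(E′, |−|_{K₂}) = (E′, |−|^α_{K₁})» (p.26 l.75 –
p.27 l.5). The non-uniformity of `α` is NOT proved here (`ActionDilates`). [claim: Joshi2021ATS1, status: disputed] -/
theorem exists_isDilatation (y y' : D.Pt) : ∃ r : ℝ, 0 < r ∧ D.IsDilatation y y' r := by
  refine ⟨D.exponent y' / D.exponent y, div_pos (D.exponent_pos y') (D.exponent_pos y), fun x => ?_⟩
  rw [D.norm_algCl_eq_rpow y' x, D.norm_algCl_eq_rpow y x, ← Real.rpow_mul (norm_nonneg _),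
    mul_div_cancel₀ _ (D.exponent_pos y).ne']

/-- The scaling exponent between `y` and `y′` is UNIQUE (the absolute value of `p` is neither `0` nor `1`), so the
dilatation factor of Thm 5.4.1 is the ratio of the exponents. [folklore] -/
theorem isDilatation_iff_eq_div (y y' : D.Pt) (r : ℝ) :
    D.IsDilatation y y' r ↔ r = D.exponent y' / D.exponent y := by
  constructor
  · intro h
    have hp := h (p : AlgebraicClosure ℚ_[p])
    rw [D.norm_algCl_eq_rpow y', D.norm_algCl_eq_rpow y, ← Real.rpow_mul (norm_nonneg _)] at hp
    -- ‖p‖ in PadicAlgCl p is p⁻¹ ∈ (0,1): rpow is injective in the exponent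
    have hnp : ‖((p : AlgebraicClosure ℚ_[p]) : PadicAlgCl p)‖ = ((p : ℝ))⁻¹ := by
      rw [← map_natCast (algebraMap ℚ_[p] (PadicAlgCl p)) p, PadicAlgCl.norm_extends, Padic.norm_p]
    rw [hnp] at hp
    have hp1 : 1 < (p : ℝ) := by exact_mod_cast (Fact.out : p.Prime).one_lt
    have h0 : 0 < ((p : ℝ))⁻¹ := inv_pos.2 (by linarith)
    have h1 : ((p : ℝ))⁻¹ ≠ 1 := (inv_lt_one_of_one_lt₀ hp1).ne
    have hinj := congrArg Real.log hp
    rw [Real.log_rpow h0, Real.log_rpow h0] at hinj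
    have hlog : Real.log ((p : ℝ)⁻¹) ≠ 0 := Real.log_ne_zero_of_pos_of_ne_one h0 h1
    have : D.exponent y' = D.exponent y * r := mul_right_cancel₀ hlog hinj
    rw [this, mul_div_cancel_left₀ _ (D.exponent_pos y).ne']
  · rintro rfl x
    rw [D.norm_algCl_eq_rpow y' x, D.norm_algCl_eq_rpow y x, ← Real.rpow_mul (norm_nonneg _),
      mul_div_cancel₀ _ (D.exponent_pos y).ne']

/-- `ActionDilates` unfolded through the exponents: some `σ` moves some point to one with a DIFFERENT exponent.
[folklore] -/
theorem actionDilates_iff_exponent_ne :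
    D.ActionDilates ↔ ∃ (σ : D.Aut) (y : D.Pt), D.exponent (D.ptAct σ y) ≠ D.exponent y := by
  constructor
  · rintro ⟨σ, y, r, -, hr1, h⟩
    have hr := (D.isDilatation_iff_eq_div y (D.ptAct σ y) r).1 h
    refine ⟨σ, y, fun heq => hr1 ?_⟩
    rw [hr, heq, div_self (D.exponent_pos y).ne']
  · rintro ⟨σ, y, hne⟩
    refine ⟨σ, y, D.exponent (D.ptAct σ y) / D.exponent y,
      div_pos (D.exponent_pos _) (D.exponent_pos y), ?_, (D.isDilatation_iff_eq_div _ _ _).2 rfl⟩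
    intro h1
    exact hne ((div_eq_one_iff_eq (D.exponent_pos y).ne').1 h1)

end UntiltPoints

end Summit.ABC.IUTFork.Joshi

end
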